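import Summits.AtomisticToContinuum.HydrodynamicLimit.Theorems.AntiMazurCoboundariesInfluenceLocalityAnchoredCoveringDivergence
import Literature.MathematicalPhysics.KineticTheory.HardSphereEuler
import HarnessLib

/-!
# Two-run chain locality for hard spheres (deterministic clean/dirty lemma of the crux
# `LightConeInLaw`, stmt-AtomisticToContinuum-12500; line `count-sufficiency-reduction`, stub 3)

The deterministic core of the TWO-COPY COUPLING step of the route `RelayRaceLocality` ("both runs'
influence chains avoid the disagreement set ⇒ equal states"; typed by crux-ideator r2-k5 as
`Cruxes/LightConeInLaw/IdeatorFiveSketch.lean: TwoRunChainLocality`), proved for every dimension `d`,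
every diameter `ε`, and ANY two particle numbers `n₁, n₂`. SETTING: two hard-sphere trajectories `Γ₁`
(`n₁` spheres), `Γ₂` (`n₂` spheres) of the same diameter on `UnitAddTorus d`; `m` MATCHED particles
embedded by injections `e₁`, `e₂`, starting in the same states; BOTH runs may have unmatched particles
— the symmetric version of the tree's true-world / forecast-world comparison `TrueAnchoredInfection`
(crux `InfluenceLocality`), whose vocabulary `infected`, `infTime`, `fresh` is reused through the
reindexed curve `(fun t j => Γ₂ t (e₂ j)) := fun t j => Γ₂ t (e₂ j)` (not a hard-sphere trajectory, so the tree's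
one-sided lemmas are re-proved here for the pair `(Γ₁, Γ₂)`).

* §1 `ne_at_infTime₂`, `infTime_pos₂`, `fst_eq_of_mem_fresh₂`, `leftLim_eq_of_mem_fresh₂`,
  `contact_iff_of_mem_fresh₂`, `apply_eq_of_contact_of_mem_fresh₂` (a contact of two FRESH matched
  particles happens in both runs with the same pre-collisional pair of states: it does not infect).
* §2 **`exists_carrier₂`** — every infection is a contact with a source: at its infection time the
  matched particle touches an unmatched particle of run 1 (in run 1), or of run 2 (in run 2), or a
  matched particle infected strictly earlier (in run 1 or in run 2).
* §3 `exists_chain_of_step` — abstract descent from a "seed or strictly-earlier carrier" alternative.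
* §4 **`twoRun_chain`** (general `d`, infection-time form) and **`twoRunChainLocality`** (`d = Fin 3`,
  VERBATIM the ideator's typed `IdeatorFive.TwoRunChainLocality`): a dirty matched particle at time
  `t ≥ 0` ends a chain of matched particles with increasing times in `(0, t]` whose first member
  touches an unmatched particle in one run and whose consecutive members touch in run 1 or run 2.

Pathwise, no probability, no speed: it is what turns a two-run cone bound into one-particle
contact/flight estimates (the relay race).
-/

namespace Summit.AtomisticToContinuum.HydrodynamicLimit.Theorems.LightConeInLawTwoRun

open Set Filter Topology Function
open Literature.Analysis Literature.Analysis.FluidPDE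
open Summit.AtomisticToContinuum.HydrodynamicLimit.Theorems.TrueAnchoredInfection

noncomputable section

/-! ## §1 The symmetric divergence lemmas

Throughout, the tree's `infected Γ F e`, `infTime Γ F e`, `fresh Γ F e τ` are used with `Γ := Γ₁`,
`e := e₁` and `F := fun t j => Γ₂ t (e₂ j)`, the second run read along the matched labels. -/

section Divergence

variable {d : Type*} [Fintype d] {ε : ℝ} {n₁ n₂ m : ℕ}
  {Γ₁ : ℝ → Config n₁ d (UnitAddTorus d)} {Γ₂ : ℝ → Config n₂ d (UnitAddTorus d)}
  {e₁ : Fin m → Fin n₁} {e₂ : Fin m → Fin n₂} {j : Fin m} {τ : ℝ}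

/-- **The infection time is attained** (two runs): at `τ_j` the two states of an infected matched
particle differ (if they agreed at `τ_j`, both runs being free flights on a right neighbourhood of
`τ_j`, they would agree a bit longer). -/
theorem ne_at_infTime₂ (h₁ : IsHardSphereTrajectory (Torus.geometry d) ε n₁ Γ₁)
    (h₂ : IsHardSphereTrajectory (Torus.geometry d) ε n₂ Γ₂)
    (hinf : j ∈ infected Γ₁ ((fun t j => Γ₂ t (e₂ j))) e₁) :
    Γ₁ (infTime Γ₁ ((fun t j => Γ₂ t (e₂ j))) e₁ j) (e₁ j) ≠ Γ₂ (infTime Γ₁ ((fun t j => Γ₂ t (e₂ j))) e₁ j) (e₂ j) := by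
  set τ₀ := infTime Γ₁ ((fun t j => Γ₂ t (e₂ j))) e₁ j with hτ₀
  intro heq
  obtain ⟨u₁, hu₁, hfree₁⟩ := h₁.exists_Ioo_right_free τ₀
  obtain ⟨u₂, hu₂, hfree₂⟩ := h₂.exists_Ioo_right_free τ₀
  have hagree : ∀ t, 0 ≤ t → t < min u₁ u₂ → Γ₁ t (e₁ j) = (fun t j => Γ₂ t (e₂ j)) t j := by
    intro t ht htu
    rcases lt_or_ge t τ₀ with hlt | hge
    · exact eq_of_lt_infTime ht hlt
    · have hf1 : Γ₁ t = freeFlight (Torus.geometry d) (t - τ₀) (Γ₁ τ₀) :=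
        h₁.eq_freeFlight_of_Ioo_free hfree₁ ⟨hge, htu.trans_le (min_le_left _ _)⟩
      have hf2 : Γ₂ t = freeFlight (Torus.geometry d) (t - τ₀) (Γ₂ τ₀) :=
        h₂.eq_freeFlight_of_Ioo_free hfree₂ ⟨hge, htu.trans_le (min_le_right _ _)⟩
      show Γ₁ t (e₁ j) = Γ₂ t (e₂ j)
      rw [hf1, hf2, freeFlight_apply, freeFlight_apply, heq]
  obtain ⟨t, ht, hne⟩ := hinf
  have hne' : {t : ℝ | 0 ≤ t ∧ Γ₁ t (e₁ j) ≠ (fun t j => Γ₂ t (e₂ j)) t j}.Nonempty := ⟨t, ht, hne⟩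
  have hle : min u₁ u₂ ≤ τ₀ := by
    refine le_csInf hne' fun s hs => ?_
    by_contra hlt
    push Not at hlt
    exact hs.2 (hagree s hs.1 hlt)
  exact (lt_min hu₁ hu₂).not_ge hle

/-- Infection times are positive (the matched particles start in the same states). -/
theorem infTime_pos₂ (h₁ : IsHardSphereTrajectory (Torus.geometry d) ε n₁ Γ₁)
    (h₂ : IsHardSphereTrajectory (Torus.geometry d) ε n₂ Γ₂)
    (h0 : ∀ j, Γ₁ 0 (e₁ j) = Γ₂ 0 (e₂ j)) (hinf : j ∈ infected Γ₁ ((fun t j => Γ₂ t (e₂ j))) e₁) :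
    0 < infTime Γ₁ ((fun t j => Γ₂ t (e₂ j))) e₁ j := by
  rcases (infTime_nonneg (Γ := Γ₁) (F := (fun t j => Γ₂ t (e₂ j))) (e := e₁) (m := j)).eq_or_lt with h | h
  · refine absurd ?_ (ne_at_infTime₂ h₁ h₂ hinf)
    rw [← h]
    exact h0 j
  · exact h

/-- A fresh matched particle has the same position in both runs at `τ` (positions are
continuous). -/
theorem fst_eq_of_mem_fresh₂ (h₁ : IsHardSphereTrajectory (Torus.geometry d) ε n₁ Γ₁)
    (h₂ : IsHardSphereTrajectory (Torus.geometry d) ε n₂ Γ₂)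
    (hfr : j ∈ fresh Γ₁ ((fun t j => Γ₂ t (e₂ j))) e₁ τ) (hτ : 0 < τ) :
    (Γ₁ τ (e₁ j)).1 = (Γ₂ τ (e₂ j)).1 := by
  have t1 : Tendsto (fun t => (Γ₁ t (e₁ j)).1) (𝓝[<] τ) (𝓝 (Γ₁ τ (e₁ j)).1) :=
    ((h₁.pos_continuous (e₁ j)).tendsto τ).mono_left nhdsWithin_le_nhds
  have t2 : Tendsto (fun t => (Γ₂ t (e₂ j)).1) (𝓝[<] τ) (𝓝 (Γ₂ τ (e₂ j)).1) :=
    ((h₂.pos_continuous (e₂ j)).tendsto τ).mono_left nhdsWithin_le_nhds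
  have heq : (fun t => (Γ₁ t (e₁ j)).1) =ᶠ[𝓝[<] τ] fun t => (Γ₂ t (e₂ j)).1 :=
    (eventuallyEq_of_mem_fresh hfr hτ).mono fun t ht => congrArg Prod.fst ht
  exact tendsto_nhds_unique (t1.congr' heq) t2

/-- A fresh matched particle has the same left limit (pre-collisional state) in both runs at
`τ`. -/
theorem leftLim_eq_of_mem_fresh₂ (h₁ : IsHardSphereTrajectory (Torus.geometry d) ε n₁ Γ₁)
    (h₂ : IsHardSphereTrajectory (Torus.geometry d) ε n₂ Γ₂)
    (hfr : j ∈ fresh Γ₁ ((fun t j => Γ₂ t (e₂ j))) e₁ τ) (hτ : 0 < τ) :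
    leftLim Γ₁ τ (e₁ j) = leftLim Γ₂ τ (e₂ j) := by
  have t1 : Tendsto (fun t => Γ₁ t (e₁ j)) (𝓝[<] τ) (𝓝 (leftLim Γ₁ τ (e₁ j))) :=
    ((continuous_apply (e₁ j)).tendsto _).comp
      (h₁.tendsto_leftLim Torus.continuous_geometry_translate τ)
  have t2 : Tendsto (fun t => Γ₂ t (e₂ j)) (𝓝[<] τ) (𝓝 (leftLim Γ₂ τ (e₂ j))) :=
    ((continuous_apply (e₂ j)).tendsto _).comp
      (h₂.tendsto_leftLim Torus.continuous_geometry_translate τ)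
  have heq : (fun t => Γ₁ t (e₁ j)) =ᶠ[𝓝[<] τ] fun t => Γ₂ t (e₂ j) :=
    eventuallyEq_of_mem_fresh hfr hτ
  exact tendsto_nhds_unique (t1.congr' heq) t2

/-- Two matched particles fresh at `τ > 0` that touch in one run touch in the other. -/
theorem contact_iff_of_mem_fresh₂ (h₁ : IsHardSphereTrajectory (Torus.geometry d) ε n₁ Γ₁)
    (h₂ : IsHardSphereTrajectory (Torus.geometry d) ε n₂ Γ₂) {j' : Fin m}
    (hfr : j ∈ fresh Γ₁ ((fun t j => Γ₂ t (e₂ j))) e₁ τ) (hfr' : j' ∈ fresh Γ₁ ((fun t j => Γ₂ t (e₂ j))) e₁ τ) (hτ : 0 < τ) :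
    Γ₁ τ ∈ contactSet (Torus.geometry d) n₁ ε (e₁ j) (e₁ j') ↔
      Γ₂ τ ∈ contactSet (Torus.geometry d) n₂ ε (e₂ j) (e₂ j') :=
  ⟨mem_contactSet_of_fst_eq (h₂.mem τ) (fst_eq_of_mem_fresh₂ h₁ h₂ hfr hτ)
      (fst_eq_of_mem_fresh₂ h₁ h₂ hfr' hτ),
    mem_contactSet_of_fst_eq (h₁.mem τ) (fst_eq_of_mem_fresh₂ h₁ h₂ hfr hτ).symm
      (fst_eq_of_mem_fresh₂ h₁ h₂ hfr' hτ).symm⟩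

/-- **A contact between two fresh matched particles does not infect**: if at `τ > 0` the fresh
matched particles `j ≠ j'` touch in run 1 (equivalently in run 2), the post-collisional states of
`j` in the two runs agree (same pre-collisional pair of states, same reflection law, which only
reads those two states). -/
theorem apply_eq_of_contact_of_mem_fresh₂ (h₁ : IsHardSphereTrajectory (Torus.geometry d) ε n₁ Γ₁)
    (h₂ : IsHardSphereTrajectory (Torus.geometry d) ε n₂ Γ₂) (he₁ : Injective e₁)
    (he₂ : Injective e₂) {j' : Fin m} (hfr : j ∈ fresh Γ₁ ((fun t j => Γ₂ t (e₂ j))) e₁ τ)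
    (hfr' : j' ∈ fresh Γ₁ ((fun t j => Γ₂ t (e₂ j))) e₁ τ) (hτ : 0 < τ) (hne : j ≠ j')
    (hc : Γ₁ τ ∈ contactSet (Torus.geometry d) n₁ ε (e₁ j) (e₁ j')) :
    Γ₁ τ (e₁ j) = Γ₂ τ (e₂ j) := by
  have hc' : Γ₂ τ ∈ contactSet (Torus.geometry d) n₂ ε (e₂ j) (e₂ j') :=
    (contact_iff_of_mem_fresh₂ h₁ h₂ hfr hfr' hτ).1 hc
  obtain ⟨-, hΓ₁⟩ := h₁.eq_collidePair_leftLim (he₁.ne hne) hc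
  obtain ⟨-, hΓ₂⟩ := h₂.eq_collidePair_leftLim (he₂.ne hne) hc'
  rw [hΓ₁, hΓ₂]
  exact collidePair_apply_eq_of_eq _ _ (he₁.ne hne) (he₂.ne hne)
    (leftLim_eq_of_mem_fresh₂ h₁ h₂ hfr hτ) (leftLim_eq_of_mem_fresh₂ h₁ h₂ hfr' hτ)

/-! ## §2 Every infection is a contact with a source -/

/-- **Two-run carrier lemma (NoSourceNoInfection, symmetric form).** At the infection time `τ_j`
of an infected matched particle `j`: either `j` touches in run 1 an UNMATCHED particle of run 1,
or `j` touches in run 2 an UNMATCHED particle of run 2, or there is a matched CARRIER `j' ≠ j`,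
infected strictly earlier, touching `j` in run 1 or in run 2. -/
theorem exists_carrier₂ (h₁ : IsHardSphereTrajectory (Torus.geometry d) ε n₁ Γ₁)
    (h₂ : IsHardSphereTrajectory (Torus.geometry d) ε n₂ Γ₂)
    (h0 : ∀ j, Γ₁ 0 (e₁ j) = Γ₂ 0 (e₂ j)) (he₁ : Injective e₁) (he₂ : Injective e₂)
    (hinf : j ∈ infected Γ₁ ((fun t j => Γ₂ t (e₂ j))) e₁) :
    (∃ c, c ∉ Set.range e₁ ∧
        Γ₁ (infTime Γ₁ ((fun t j => Γ₂ t (e₂ j))) e₁ j) ∈ contactSet (Torus.geometry d) n₁ ε (e₁ j) c) ∨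
      (∃ c, c ∉ Set.range e₂ ∧
        Γ₂ (infTime Γ₁ ((fun t j => Γ₂ t (e₂ j))) e₁ j) ∈ contactSet (Torus.geometry d) n₂ ε (e₂ j) c) ∨
      ∃ j', j' ≠ j ∧ j' ∈ infected Γ₁ ((fun t j => Γ₂ t (e₂ j))) e₁ ∧
        infTime Γ₁ ((fun t j => Γ₂ t (e₂ j))) e₁ j' < infTime Γ₁ ((fun t j => Γ₂ t (e₂ j))) e₁ j ∧
        (Γ₁ (infTime Γ₁ ((fun t j => Γ₂ t (e₂ j))) e₁ j) ∈ contactSet (Torus.geometry d) n₁ ε (e₁ j) (e₁ j') ∨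
          Γ₂ (infTime Γ₁ ((fun t j => Γ₂ t (e₂ j))) e₁ j) ∈ contactSet (Torus.geometry d) n₂ ε (e₂ j) (e₂ j')) := by
  set τ₀ := infTime Γ₁ ((fun t j => Γ₂ t (e₂ j))) e₁ j with hτ₀
  have hτ : 0 < τ₀ := infTime_pos₂ h₁ h₂ h0 hinf
  have hfr : j ∈ fresh Γ₁ ((fun t j => Γ₂ t (e₂ j))) e₁ τ₀ := mem_fresh_infTime
  have hne : Γ₁ τ₀ (e₁ j) ≠ Γ₂ τ₀ (e₂ j) := ne_at_infTime₂ h₁ h₂ hinf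
  by_cases hcon : ∃ c, c ≠ e₁ j ∧ Γ₁ τ₀ ∈ contactSet (Torus.geometry d) n₁ ε (e₁ j) c
  · -- a contact of `e₁ j` in run 1 at `τ₀`
    obtain ⟨c, hcj, hc⟩ := hcon
    by_cases hcS : c ∈ Set.range e₁
    · obtain ⟨j', rfl⟩ := hcS
      have hjj : j' ≠ j := fun h => hcj (congrArg e₁ h)
      refine Or.inr (Or.inr ⟨j', hjj, ?_⟩)
      by_contra hnot
      have hfr' : j' ∈ fresh Γ₁ ((fun t j => Γ₂ t (e₂ j))) e₁ τ₀ :=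
        mem_fresh_of_not fun h => hnot ⟨h.1, h.2, Or.inl hc⟩
      exact hne (apply_eq_of_contact_of_mem_fresh₂ h₁ h₂ he₁ he₂ hfr hfr' hτ hjj.symm hc)
    · exact Or.inl ⟨c, hcS, hc⟩
  · push Not at hcon
    -- no contact of `e₁ j` in run 1 at `τ₀`: the run-1 state of `j` does not jump
    have hl₁ : Γ₁ τ₀ (e₁ j) = leftLim Γ₁ τ₀ (e₁ j) :=
      apply_eq_leftLim_of_forall_not_contact h₁ fun c hc => hcon c hc
    -- hence the run-2 state of `j` jumps: a contact of `e₂ j` in run 2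
    have hj₂ : Γ₂ τ₀ (e₂ j) ≠ leftLim Γ₂ τ₀ (e₂ j) := by
      rw [← leftLim_eq_of_mem_fresh₂ h₁ h₂ hfr hτ, ← hl₁]
      exact hne.symm
    obtain ⟨c, hcj, hc'⟩ :
        ∃ c, c ≠ e₂ j ∧ Γ₂ τ₀ ∈ contactSet (Torus.geometry d) n₂ ε (e₂ j) c := by
      by_contra hall
      push Not at hall
      exact hj₂ (apply_eq_leftLim_of_forall_not_contact h₂ fun c hc => hall c hc)
    by_cases hcS : c ∈ Set.range e₂
    · obtain ⟨j', rfl⟩ := hcS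
      have hjj : j' ≠ j := fun h => hcj (congrArg e₂ h)
      refine Or.inr (Or.inr ⟨j', hjj, ?_⟩)
      by_contra hnot
      have hfr' : j' ∈ fresh Γ₁ ((fun t j => Γ₂ t (e₂ j))) e₁ τ₀ :=
        mem_fresh_of_not fun h => hnot ⟨h.1, h.2, Or.inr hc'⟩
      exact hcon (e₁ j') (he₁.ne hjj) ((contact_iff_of_mem_fresh₂ h₁ h₂ hfr hfr' hτ).2 hc')
    · exact Or.inr (Or.inl ⟨c, hcS, hc'⟩)

omit [Fintype d] in
/-- A matched particle whose two states differ at a time `t ≥ 0` is infected, with infection time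
`≤ t`. -/
theorem mem_infected_of_ne {t : ℝ} (ht : 0 ≤ t) (hne : Γ₁ t (e₁ j) ≠ Γ₂ t (e₂ j)) :
    j ∈ infected Γ₁ ((fun t j => Γ₂ t (e₂ j))) e₁ ∧ infTime Γ₁ ((fun t j => Γ₂ t (e₂ j))) e₁ j ≤ t :=
  ⟨⟨t, ht, hne⟩, infTime_le ht hne⟩

end Divergence

/-! ## §3 Abstract descent: seeds, strictly earlier carriers, chains -/

section Descent

variable {α : Type*}

/-- **Chains from a seed-or-earlier-carrier alternative.** On a finite type, if every element of
`I` is a seed or has a carrier in `I` with strictly smaller time linked to it, then every element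
of `I` is the end of a chain `q 0, …, q L` in `I` starting at a seed, with strictly increasing
times and consecutive members linked. (Descent on the number of elements of strictly smaller
time.) -/
theorem exists_chain_of_step [Fintype α] (I : Set α) (τ : α → ℝ) (Seed : α → Prop)
    (Link : α → α → Prop)
    (hstep : ∀ j ∈ I, Seed j ∨ ∃ j' ∈ I, τ j' < τ j ∧ Link j' j) :
    ∀ j ∈ I, ∃ (L : ℕ) (q : Fin (L + 1) → α), q (Fin.last L) = j ∧ (∀ l, q l ∈ I) ∧
      Seed (q 0) ∧ StrictMono (τ ∘ q) ∧ ∀ l : Fin L, Link (q l.castSucc) (q l.succ) := by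
  classical
  -- descent on the number of elements of strictly smaller time
  suffices H : ∀ (n : ℕ) (j : α), (Finset.univ.filter fun j' => τ j' < τ j).card = n → j ∈ I →
      ∃ (L : ℕ) (q : Fin (L + 1) → α), q (Fin.last L) = j ∧ (∀ l, q l ∈ I) ∧
        Seed (q 0) ∧ StrictMono (τ ∘ q) ∧ ∀ l : Fin L, Link (q l.castSucc) (q l.succ) from
    fun j hj => H _ j rfl hj
  intro n
  induction n using Nat.strong_induction_on with
  | _ n ih =>
    intro j hcard hj
    rcases hstep j hj with hseed | ⟨j', hj', hlt, hlink⟩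
    · refine ⟨0, fun _ => j, rfl, fun _ => hj, hseed, ?_, fun l => l.elim0⟩
      intro a b hab
      exact absurd hab (by simp [Fin.eq_zero a, Fin.eq_zero b])
    · -- the carrier has strictly fewer elements of smaller time
      have hsub : (Finset.univ.filter fun j'' => τ j'' < τ j') ⊂
          (Finset.univ.filter fun j'' => τ j'' < τ j) := by
        rw [Finset.ssubset_iff_subset_ne]
        refine ⟨fun x hx => ?_, fun h => ?_⟩
        · simp only [Finset.mem_filter, Finset.mem_univ, true_and] at hx ⊢
          exact hx.trans hlt
        · have : j' ∈ Finset.univ.filter fun j'' => τ j'' < τ j := by simp [hlt]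
          rw [← h] at this
          simp at this
      obtain ⟨L, q, hqlast, hqI, hqseed, hqmono, hqlink⟩ :=
        ih _ (hcard ▸ Finset.card_lt_card hsub) j' rfl hj'
      refine ⟨L + 1, Fin.snoc q j, ?_, ?_, ?_, ?_, ?_⟩
      · simp [Fin.snoc_last]
      · intro l
        refine Fin.lastCases ?_ (fun i => ?_) l
        · simpa [Fin.snoc_last] using hj
        · simpa [Fin.snoc_castSucc] using hqI i
      · have : (Fin.snoc q j : Fin (L + 2) → α) 0 = q 0 := by
          rw [← Fin.castSucc_zero, Fin.snoc_castSucc]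
        rw [this]; exact hqseed
      · rw [Fin.strictMono_iff_lt_succ]
        intro i
        refine Fin.lastCases ?_ (fun i' => ?_) i
        · simp only [comp_apply, Fin.succ_last, Fin.snoc_last, Fin.snoc_castSucc, hqlast]
          exact hlt
        · simp only [comp_apply, Fin.snoc_castSucc]
          rw [← Fin.castSucc_succ i', Fin.snoc_castSucc]
          exact hqmono (Fin.castSucc_lt_succ (i := i'))
      · intro l
        refine Fin.lastCases ?_ (fun l' => ?_) l
        · simp only [Fin.succ_last, Fin.snoc_last, Fin.snoc_castSucc, hqlast]
          exact hlink
        · have h1 : (Fin.snoc q j : Fin (L + 2) → α) l'.castSucc.castSucc = q l'.castSucc :=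
            Fin.snoc_castSucc _ _ _
          have h2 : (Fin.snoc q j : Fin (L + 2) → α) l'.castSucc.succ = q l'.succ := by
            rw [← Fin.castSucc_succ] ; exact Fin.snoc_castSucc _ _ _
          rw [h1, h2]
          exact hqlink l'

end Descent

/-! ## §4 Two-run chain locality -/

section Chain

variable {d : Type*} [Fintype d] {ε : ℝ} {n₁ n₂ m : ℕ}
  {Γ₁ : ℝ → Config n₁ d (UnitAddTorus d)} {Γ₂ : ℝ → Config n₂ d (UnitAddTorus d)}
  {e₁ : Fin m → Fin n₁} {e₂ : Fin m → Fin n₂}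

/-- **Two-run chain locality (general dimension; infection-time form).** If the matched particle
`k₀` is dirty at time `t ≥ 0`, there is a chain of INFECTED matched particles `q 0, …, q L = k₀`
with strictly increasing infection times `τ_{q 0} < ⋯ < τ_{q L} ≤ t`, `0 < τ_{q 0}`, whose first
member touches at its infection time an unmatched particle (in run 1 or in run 2), and whose
consecutive members `q l`, `q (l+1)` are in contact at time `τ_{q (l+1)}` in run 1 or in run 2. -/
theorem twoRun_chain (h₁ : IsHardSphereTrajectory (Torus.geometry d) ε n₁ Γ₁)
    (h₂ : IsHardSphereTrajectory (Torus.geometry d) ε n₂ Γ₂) (he₁ : Injective e₁) (he₂ : Injective e₂)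
    (h0 : ∀ j, Γ₁ 0 (e₁ j) = Γ₂ 0 (e₂ j)) {t : ℝ} (ht : 0 ≤ t) {k₀ : Fin m}
    (hk₀ : Γ₁ t (e₁ k₀) ≠ Γ₂ t (e₂ k₀)) :
    ∃ (L : ℕ) (q : Fin (L + 1) → Fin m), q (Fin.last L) = k₀ ∧
      (∀ l, q l ∈ infected Γ₁ ((fun t j => Γ₂ t (e₂ j))) e₁) ∧
      StrictMono (fun l => infTime Γ₁ ((fun t j => Γ₂ t (e₂ j))) e₁ (q l)) ∧
      (∀ l, 0 < infTime Γ₁ ((fun t j => Γ₂ t (e₂ j))) e₁ (q l) ∧ infTime Γ₁ ((fun t j => Γ₂ t (e₂ j))) e₁ (q l) ≤ t) ∧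
      ((∃ c, c ∉ Set.range e₁ ∧ Γ₁ (infTime Γ₁ ((fun t j => Γ₂ t (e₂ j))) e₁ (q 0)) ∈
            contactSet (Torus.geometry d) n₁ ε (e₁ (q 0)) c) ∨
        (∃ c, c ∉ Set.range e₂ ∧ Γ₂ (infTime Γ₁ ((fun t j => Γ₂ t (e₂ j))) e₁ (q 0)) ∈
            contactSet (Torus.geometry d) n₂ ε (e₂ (q 0)) c)) ∧
      ∀ l : Fin L,
        Γ₁ (infTime Γ₁ ((fun t j => Γ₂ t (e₂ j))) e₁ (q l.succ)) ∈
            contactSet (Torus.geometry d) n₁ ε (e₁ (q l.castSucc)) (e₁ (q l.succ)) ∨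
          Γ₂ (infTime Γ₁ ((fun t j => Γ₂ t (e₂ j))) e₁ (q l.succ)) ∈
            contactSet (Torus.geometry d) n₂ ε (e₂ (q l.castSucc)) (e₂ (q l.succ)) := by
  set I : Set (Fin m) := infected Γ₁ ((fun t j => Γ₂ t (e₂ j))) e₁ with hI
  set τ : Fin m → ℝ := fun j => infTime Γ₁ ((fun t j => Γ₂ t (e₂ j))) e₁ j with hτ
  set Seed : Fin m → Prop := fun j =>
    (∃ c, c ∉ Set.range e₁ ∧ Γ₁ (τ j) ∈ contactSet (Torus.geometry d) n₁ ε (e₁ j) c) ∨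
      ∃ c, c ∉ Set.range e₂ ∧ Γ₂ (τ j) ∈ contactSet (Torus.geometry d) n₂ ε (e₂ j) c with hSeed
  set Link : Fin m → Fin m → Prop := fun j' j =>
    Γ₁ (τ j) ∈ contactSet (Torus.geometry d) n₁ ε (e₁ j') (e₁ j) ∨
      Γ₂ (τ j) ∈ contactSet (Torus.geometry d) n₂ ε (e₂ j') (e₂ j) with hLink
  have hstep : ∀ j ∈ I, Seed j ∨ ∃ j' ∈ I, τ j' < τ j ∧ Link j' j := by
    intro j hj
    rcases exists_carrier₂ h₁ h₂ h0 he₁ he₂ hj with hs | hs | ⟨j', -, hj', hlt, hc⟩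
    · exact Or.inl (Or.inl hs)
    · exact Or.inl (Or.inr hs)
    · refine Or.inr ⟨j', hj', hlt, ?_⟩
      rcases hc with hc | hc
      · exact Or.inl (mem_contactSet_comm.1 hc)
      · exact Or.inr (mem_contactSet_comm.1 hc)
  obtain ⟨hk₀I, hk₀t⟩ := mem_infected_of_ne (e₁ := e₁) (e₂ := e₂) ht hk₀
  obtain ⟨L, q, hqlast, hqI, hqseed, hqmono, hqlink⟩ :=
    exists_chain_of_step I τ Seed Link hstep k₀ hk₀I
  refine ⟨L, q, hqlast, hqI, hqmono, fun l => ⟨?_, ?_⟩, hqseed, hqlink⟩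
  · exact infTime_pos₂ h₁ h₂ h0 (hqI l)
  · have hlast : τ (q (Fin.last L)) ≤ t := by rw [hqlast]; exact hk₀t
    exact (hqmono.monotone (Fin.le_last l)).trans hlast

open Literature.MathematicalPhysics.KineticTheory in
/-- **TWO-RUN CHAIN LOCALITY on `𝕋³`** — verbatim the crux-ideator's typed statement
`Cruxes/LightConeInLaw/IdeatorFiveSketch.lean: IdeatorFive.TwoRunChainLocality` (deterministic
clean/dirty lemma of the two-copy coupling): two hard-sphere trajectories `γ` (`n` spheres) and
`γ'` (`n'` spheres) of the SAME diameter `ε` on `𝕋³`; `m` matched particles, embedded by injections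
`e`, `e'`, start in the same states. If at a time `t ≥ 0` the matched particle `k₀` is DIRTY, then
there is a chain of matched particles `q 0, …, q L = k₀` with monotone times
`0 < s 0 ≤ … ≤ s L ≤ t` such that the first member is in contact, at time `s 0`, with an UNMATCHED
particle in one of the two runs, and consecutive members `q l`, `q (l+1)` are in contact at time
`s (l+1)` in run `γ` or in run `γ'`. (From `twoRun_chain`, with `s l` the infection times.) -/
theorem twoRunChainLocality :
    ∀ (n n' m : ℕ) (ε : ℝ) (γ : ℝ → Config n (Fin 3) T3) (γ' : ℝ → Config n' (Fin 3) T3),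
    IsHardSphereTrajectory (Torus.geometry (Fin 3)) ε n γ →
    IsHardSphereTrajectory (Torus.geometry (Fin 3)) ε n' γ' →
    ∀ (e : Fin m → Fin n) (e' : Fin m → Fin n'), Function.Injective e → Function.Injective e' →
    (∀ k, γ 0 (e k) = γ' 0 (e' k)) →
    ∀ t : ℝ, 0 ≤ t → ∀ k₀ : Fin m, γ t (e k₀) ≠ γ' t (e' k₀) →
      ∃ (L : ℕ) (q : Fin (L + 1) → Fin m) (s : Fin (L + 1) → ℝ),
        q (Fin.last L) = k₀ ∧ Monotone s ∧ (∀ l, 0 < s l ∧ s l ≤ t) ∧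
        ((∃ i : Fin n, i ∉ Set.range e ∧
            γ (s 0) ∈ contactSet (Torus.geometry (Fin 3)) n ε (e (q 0)) i) ∨
          (∃ i' : Fin n', i' ∉ Set.range e' ∧
            γ' (s 0) ∈ contactSet (Torus.geometry (Fin 3)) n' ε (e' (q 0)) i')) ∧
        (∀ l : Fin L,
          γ (s l.succ) ∈ contactSet (Torus.geometry (Fin 3)) n ε (e (q l.castSucc)) (e (q l.succ)) ∨
          γ' (s l.succ) ∈
            contactSet (Torus.geometry (Fin 3)) n' ε (e' (q l.castSucc)) (e' (q l.succ))) := by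
  intro n n' m ε γ γ' hγ hγ' e e' he he' h0 t ht k₀ hk₀
  obtain ⟨L, q, hqlast, -, hmono, hbounds, hseed, hlink⟩ := twoRun_chain hγ hγ' he he' h0 ht hk₀
  exact ⟨L, q, fun l => infTime γ ((fun t j => γ' t (e' j))) e (q l), hqlast, hmono.monotone, hbounds, hseed,
    hlink⟩

end Chain

end

end Summit.AtomisticToContinuum.HydrodynamicLimit.Theorems.LightConeInLawTwoRun
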